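import Summits.QuantumFields.BalabanUV.T4Continuum.Spine.NE5.TwoRunPencilDiagonal
import Summits.QuantumFields.YangMills.Theorems.BalabanUVNodesN18Knit

/-!
# BalabanUVNodes ∕ N18 two-run record — the END's per-term record binder `TermWalkData (𝒦 j Z t φ) (w j)` FROM TWO RUNS'
# walk witnesses, termwise `r_j`-close, under rows NE2∕NE3's RATE `r_j ≤ C₂θ^j` (Track A, DAG node N18; cluster K4
# «SpineRates»; the junction of `ne/NE5-JUNCTION.md` v2.1 item 7 in kernel form, per term)

HONEST FRAMING.  Count-neutral kernel bookkeeping: T42 `Spine.NE5.TwoRunPencilDiagonal.termWalkData_pencil_diag` composed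
with the junction inequality `BalabanUVNodesN18Knit.window_radius_le_reach` and the END's package equations; the two runs'
witnesses, their closeness `r`, the reach `s` and every letter are HYPOTHESES; nothing of Bałaban's is constructed or
asserted (NODE O's instance is 0∕1); NE5 NOT IN PRINT and NOT PROVED; one finite four-torus programme at fixed ε; nothing
continuum ∕ ℝ⁴ ∕ OS ∕ mass-gap ∕ Clay.  0 `sorry`, 0 `def`, standard axioms.

THE POINT.  The END of row NE5 (T53 `TwoRunTorusNE5Final8.ne5_end_final_all8`; in the K4 family shape:
`BalabanUVNodesN18End.n18_family_of_end8`) reads, at every WINDOW scale `θ^j < s′` and per (2.14)-term, ONE pencil record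
`TermWalkData (𝒦 j Z t φ) (w j)` whose package `w j` it EXPORTS: `(w j).R = max 2 (s′∕θ^j)·C_R`, `(w j).Rσ = max R_σ0 C_σ`,
letters `(K̄_Γ, K̄_E, K̄_C, κ, ε)` the producer's.  NODE O does not hold pencil records; it holds (once built) EACH RUN's
(v)⁺ walk witnesses, and rows NE2∕NE3 owe their termwise closeness `r_j ≤ C₂θ^j` (King's «difference of propagators on one
line», [King1986] p. 665, in walk-weighted currency).  `termWalkData_of_twoRuns_at_window`: with the producer's margin
chosen as `s′ := s∕(2C₂C_R)` (`s` = T42's Neumann reach), at a window scale `θ^j < s′` the END's exported package IS met by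
the diagonal-pencil record of two runs' witnesses that are termwise `r`-close with `r ≤ C₂θ^j` — T42's hypotheses
VERBATIM (Γ-kernels, precisions, run A's covariance walk data, Neumann letters, smallness `q < 1` in the reach), plus
the run witnesses' radius covering the package radius (`(w j).R ≤ R`), plus the package's field equations with the END's
letters `K̄_Γ^END = (1+s)K̄_Γ`, `K̄_E^END = (1+s)K̄_E`, `K̄_C^END = K̄_C(1−q)⁻¹`.  So the producer names ITS letters to the
END as those three, takes `s′ = s∕(2C₂C_R)` with the END's `C_R`, and feeds this theorem into the END's `h𝒦` binder term
by term; the rate is rows NE2∕NE3's, the rest is NODE O's.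

Sources: T. Bałaban, CMP **116** (1988) [Balaban1988RG2Cluster] (1.5) p. 3, (1.11) p. 5, p. 13, p. 15, (2.16) p. 16;
CMP **99** (1985) [Balaban1985BackgroundPropagators] Thm 3.10 p. 416, (3.130) p. 421; C. King, CMP **102** (1986)
[King1986] p. 665.  Nothing here is a claim about the Yang–Mills mass gap.
-/

noncomputable section

namespace Summit.QuantumFields.YangMills.BalabanUVNodes.N18TwoRunRecord

open Metric Set Matrix Finset
open Literature.MathematicalPhysics.QuantumFieldTheory.Balaban1983to89
open Literature.MathematicalPhysics.QuantumFieldTheory.Balaban1983to89.B9SectDWalk (MajSumLe DomBy)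
open Literature.MathematicalPhysics.QuantumFieldTheory.Balaban1983to89.B9Thm34Ext (toB6)
open Literature.MathematicalPhysics.QuantumFieldTheory.Balaban1983to89.B9Thm37GlueTorus (torusGeom tdist1)
open Literature.MathematicalPhysics.QuantumFieldTheory.Balaban1983to89.TreeLengthTorus (TPt)
open Literature.MathematicalPhysics.QuantumFieldTheory.Balaban1983to89.B5TorusCover (UT)
open Literature.MathematicalPhysics.QuantumFieldTheory.Balaban1983to89.B11SectG (RowSum)
open Literature.MathematicalPhysics.QuantumFieldTheory.Balaban1983to89.B13JointWalkExpansion (JointWalkExpansion)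
open Literature.MathematicalPhysics.QuantumFieldTheory.Balaban1983to89.B13TermWalkData (WalkConsts TermKernels TermWalkData)
open Summit.QuantumFields.BalabanUV.T4Continuum.Spine.NE5.TwoRunPencilDiagonal (termWalkData_pencil_diag)
open Summit.QuantumFields.YangMills.BalabanUVNodes.N18Knit (window_radius_le_reach)

variable {d N' : ℕ} {ν : ℕ} {Nf : Fin ν → ℕ} [∀ i, NeZero (Nf i)] {c : B13.Consts}

/-- **THE END'S RECORD BINDER FROM TWO RUNS' WITNESSES UNDER THE RATE (per term, at a window scale).**  T42's data
VERBATIM — a record `𝒦` whose Γ-kernel and precision ARE the diagonal pencils of run A's and run B's families; (Γ), (E)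
both runs' joint walk expansions on common skeletons through `𝒦.X`, termwise `r`-close; (C) run A's covariance walk
data, the Neumann letters and the smallness `q = (mc₁)((mc₁)K̄_C(sK̄_E)c′)c′ < 1` in the reach `s`; the σ-distance `R_σ`;
common drop `ε′` and torus rate `κ′` — PLUS rows NE2∕NE3's rate `r ≤ C₂θ^j`, the window condition `θ^j < s∕(2C₂C_R)`,
and a package `wj` with the END's field equations (`wj.R = max 2 ((s∕(2C₂C_R))∕θ^j)·C_R ≤ R`, letters `(1+s)K̄_Γ`,
`(1+s)K̄_E`, `K̄_C(1−q)⁻¹`, `κ′`, `ε′`, `R_σ`) ⟹ `TermWalkData 𝒦 wj`.  Proof: the junction inequality gives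
`wj.R ≤ s∕r`, then T42. [cite: Balaban1988RG2Cluster, (1.5) p.3, (1.11) p.5, p.13, p.15, (2.16) p.16; Balaban1985BackgroundPropagators, Thm 3.10 p.416, (3.130) p.421; King1986, p.665] -/
theorem termWalkData_of_twoRuns_at_window (𝒦 : TermKernels c d N' ν Nf ℂ)
    {GA GB : (TPt d N' → ℂ) → ℂ → Matrix 𝒦.Λ (𝒦.Λ ⊕ 𝒦.C₀) ℂ} {AA AB : (TPt d N' → ℂ) → ℂ → Matrix 𝒦.Λ 𝒦.Λ ℂ}
    (hG2 : ∀ σ b, 𝒦.G2 σ b = GA σ b + b • (GB σ b - GA σ b))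
    (hA2 : ∀ σ b, 𝒦.A2 σ b = AA σ b + b • (AB σ b - AA σ b))
    -- (Γ) the Γ-kernels of the two runs: one skeleton, termwise `r`-close
    {WΓ : Type} {TΓA TΓB : WΓ → (TPt d N' → ℂ) → ℂ → Matrix 𝒦.Λ (𝒦.Λ ⊕ 𝒦.C₀) ℂ} {SXΓ : Set WΓ} {AΓ AΓB : WΓ → ℝ}
    {DΓ : WΓ → UT Nf → UT Nf → ℝ} {R RΓB ρΓ ρΓB εΓ εΓB kapΓ kapΓB KΓ KΓB r s : ℝ}
    (hΓA : JointWalkExpansion c 𝒦.locΛ 𝒦.locN GA 𝒦.X R εΓ kapΓ KΓ TΓA SXΓ AΓ DΓ ρΓ)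
    (hΓB : JointWalkExpansion c 𝒦.locΛ 𝒦.locN GB 𝒦.X RΓB εΓB kapΓB KΓB TΓB SXΓ AΓB DΓ ρΓB) (hRΓB : R ≤ RΓB)
    (hdiffΓ : ∀ ω, ∀ σ : TPt d N' → ℂ, (∀ j, ‖σ j‖ ≤ Real.exp c.κ₁) → ∀ u ∈ ball (0 : ℂ) R,
      ∀ i j, ‖TΓB ω σ u i j - TΓA ω σ u i j‖ ≤ r * (AΓ ω * Real.exp (-(ρΓ * DΓ ω (𝒦.locΛ i) (𝒦.locN j)))))
    -- (E) the precisions of the two runs: one skeleton, termwise `r`-close, walks dominating distance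
    {WE : Type} {TEA TEB : WE → (TPt d N' → ℂ) → ℂ → Matrix 𝒦.Λ 𝒦.Λ ℂ} {SXE : Set WE} {AE AEB : WE → ℝ}
    {DE : WE → UT Nf → UT Nf → ℝ} {REB ρE ρEB εE εEB kapE kapEB KE KEB : ℝ}
    (hEA : JointWalkExpansion c 𝒦.locΛ 𝒦.locΛ AA 𝒦.X R εE kapE KE TEA SXE AE DE ρE)
    (hEB : JointWalkExpansion c 𝒦.locΛ 𝒦.locΛ AB 𝒦.X REB εEB kapEB KEB TEB SXE AEB DE ρEB) (hREB : R ≤ REB)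
    (hdiffE : ∀ ω, ∀ σ : TPt d N' → ℂ, (∀ j, ‖σ j‖ ≤ Real.exp c.κ₁) → ∀ u ∈ ball (0 : ℂ) R,
      ∀ i j, ‖TEB ω σ u i j - TEA ω σ u i j‖ ≤ r * (AE ω * Real.exp (-(ρE * DE ω (𝒦.locΛ i) (𝒦.locΛ j)))))
    (hEdom : ∀ ω, DomBy (toB6 (torusGeom Nf 0 0 0) 0 True) (DE ω))
    -- (C) run A's covariance `C_A = A_A⁻¹` with its walk data, and the Neumann letters
    {WC : Type} {TC : WC → (TPt d N' → ℂ) → ℂ → Matrix 𝒦.Λ 𝒦.Λ ℂ} {Cm : (TPt d N' → ℂ) → ℂ → Matrix 𝒦.Λ 𝒦.Λ ℂ}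
    {AC : WC → ℝ} {DC : WC → UT Nf → UT Nf → ℝ} {ρC rC κC KbarC ρ ρs σ₁ c₁ σ' c' κs κ : ℝ} {m : ℕ}
    (hCsum : ∀ σ₀ : TPt d N' → ℂ, (∀ j, ‖σ₀ j‖ ≤ Real.exp c.κ₁) → ∀ u ∈ ball (0 : ℂ) R,
      ∀ i k, HasSum (fun ω => TC ω σ₀ u i k) (Cm σ₀ u i k))
    (hCmaj : ∀ ω, ∀ σ₀ : TPt d N' → ℂ, (∀ j, ‖σ₀ j‖ ≤ Real.exp c.κ₁) → ∀ u ∈ ball (0 : ℂ) R,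
      ∀ i k, ‖TC ω σ₀ u i k‖ ≤ AC ω * Real.exp (-(ρC * DC ω (𝒦.locΛ i) (𝒦.locΛ k))))
    (hCms : MajSumLe (g := toB6 (torusGeom Nf 0 0 0) 0 True) (fun ω a b => AC ω * Real.exp (-(rC * DC ω a b)))
      (fun a b => KbarC * Real.exp (-(κC * tdist1 Nf a b))))
    (hCdom : ∀ ω, DomBy (toB6 (torusGeom Nf 0 0 0) 0 True) (DC ω)) (hAC0 : ∀ ω, 0 ≤ AC ω)
    (hAC : ∀ σ₀ : TPt d N' → ℂ, (∀ j, ‖σ₀ j‖ ≤ Real.exp c.κ₁) → ∀ u ∈ ball (0 : ℂ) R, AA σ₀ u * Cm σ₀ u = 1)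
    (hfib : ∀ y : UT Nf, (Finset.univ.filter fun k => 𝒦.locΛ k = y).card ≤ m)
    (hrow : RowSum (toB6 (torusGeom Nf 0 0 0) 0 True) σ₁ c₁) (hrow' : RowSum (toB6 (torusGeom Nf 0 0 0) 0 True) σ' c')
    (hσ₁ : 0 ≤ σ₁) (hσ' : 0 ≤ σ') (hc₁ : 0 ≤ c₁) (hc' : 0 ≤ c')
    (hρ : 0 ≤ ρ) (hρs : ρ + σ₁ ≤ ρs) (hρsC : ρs ≤ ρC) (hρsE : ρs + σ₁ ≤ ρE) (hrC : rC ≤ ρ) (hrE : ρE - εE ≤ ρ)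
    (hKC : 0 ≤ KbarC) (hKΓ0 : 0 ≤ KΓ) (hKE0 : 0 ≤ KE)
    (hκs : 0 ≤ κs) (hκsE : κs ≤ kapE) (hκsC : κs + σ' ≤ κC) (hκ : 0 ≤ κ) (hκC : κ ≤ κC) (hκκs : κ + σ' ≤ κs)
    (hq : (m * c₁) * ((m * c₁) * KbarC * (s * KE) * c') * c' < 1)
    {Rσ : ℝ} (hfar : ∀ b : 𝒦.Λ, ∀ z ∈ 𝒦.X, Rσ ≤ tdist1 Nf (𝒦.locΛ b) z)
    {ε' kap' : ℝ} (hε'Γ : ε' ≤ εΓ) (hε'E : ε' ≤ εE) (hkap'Γ : kap' ≤ kapΓ) (hkap'E : kap' ≤ kapE) (hkap'κ : kap' ≤ κ)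
    -- rows NE2∕NE3's RATE for the termwise closeness, and the END's package at this (window) scale
    (wj : WalkConsts) {θ C₂ CR : ℝ} {j : ℕ} (hθ : 0 < θ) (hs : 0 < s) (hC₂ : 0 < C₂) (hCR : 0 < CR) (hr : 0 < r)
    (hrate : r ≤ C₂ * θ ^ j) (hj : θ ^ j < s / (2 * C₂ * CR))
    (hR : wj.R = max 2 (s / (2 * C₂ * CR) / θ ^ j) * CR) (hRA : wj.R ≤ R)
    (hwε : wj.ε = ε') (hwkap : wj.kap = kap') (hwΓ : wj.KbarΓ = (1 + s) * KΓ) (hwE : wj.KbarE = (1 + s) * KE)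
    (hwC : wj.KbarC = KbarC * (1 - (m * c₁) * ((m * c₁) * KbarC * (s * KE) * c') * c')⁻¹) (hwσ : wj.Rσ = Rσ) :
    TermWalkData 𝒦 wj := by
  obtain ⟨R₁, ε₁, kap₁, KΓ₁, KE₁, KC₁, Rσ₁⟩ := wj
  simp only at hR hRA hwε hwkap hwΓ hwE hwC hwσ
  subst hwε hwkap hwΓ hwE hwC hwσ
  have hR'0 : 0 < R₁ := by
    rw [hR]; exact mul_pos (lt_of_lt_of_le two_pos (le_max_left _ _)) hCR
  have hR's : R₁ ≤ s / r := by
    rw [hR]; exact window_radius_le_reach hθ hs hC₂ hCR hr hrate hj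
  exact termWalkData_pencil_diag 𝒦 hG2 hA2 hΓA hΓB hRΓB hdiffΓ hEA hEB hREB hdiffE hEdom hCsum hCmaj hCms hCdom hAC0
    hAC hfib hrow hrow' hσ₁ hσ' hc₁ hc' hρ hρs hρsC hρsE hrC hrE hKC hKΓ0 hKE0 hκs hκsE hκsC hκ hκC hκκs hq hr hs.le
    hR'0 hRA hR's hfar hε'Γ hε'E hkap'Γ hkap'E hkap'κ

end Summit.QuantumFields.YangMills.BalabanUVNodes.N18TwoRunRecord

end
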